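import Summits.AtomisticToContinuum.HydrodynamicLimit.Theses.ExpTailStaging

/-!
# Birth skeleton (BC3) for the crux `MesoFluxClosure` (stmt-AtomisticToContinuum-9450), line `birth`

Route `ExpTailStaging` (`Summits/AtomisticToContinuum/HydrodynamicLimit/Theses/ExpTailStaging.lean`, crux
rank 3; the SAME statement is the rank-0 target of route `HeatBathForgetting`, whose route file is imported
transitively, so this skeleton concludes both copies — `MesoFluxClosure_of` for ExpTailStaging (the registered
one) and `MesoFluxClosure_of_heatBathForgetting`).

The crux, read back. Along the TRUE deterministic hard-sphere evolution from local Gibbs data (continuous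
profiles `a₀, θ₀ > 0`, `u₀`; `0 < σ < σ₀(profiles)`; a classical hard-sphere Euler solution `(ρ,u,θ)` on
`[0,T)`; a flow family `Φ_N`; the `t = 0` law of large numbers `TendstoHydroFieldsAt … 0`) there is ONE
mesoscopic block exponent `α ∈ (0, 1/3)` (block scale `h_N = (N+1)^{-α}`, blocks of `(N+1)^{1-3α} → ∞`
particles) such that for all `t < T`, `0 ≤ t₁ ≤ t₂ ≤ t`, smooth `ζ` and `δ > 0`, eventually in `N`, under the
initial local Gibbs law `P_N`:
* ENERGY LAW: the defect `Den = ⟨e_N(t₂) − e_N(t₁), ζ⟩ − ∫_{t₁}^{t₂}∫ (e_h + p_h)/ρ_h · (m_h·∇ζ) dx ds` is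
  `P_N`-integrable with `|E Den| ≤ δ` (the empirical energy balance closes IN MEAN on the Euler enthalpy flux
  evaluated at the `h_N`-mollified empirical fields, `p_h = hsPressure σ ρ_h θ_h`), AND
* MOMENTUM LAWS: for `k = 1,2,3` the defect `Dmo k = ⟨m_N(t₂) − m_N(t₁), ζ⟩_k − ∫_{t₁}^{t₂}∫ [(m_h·∇ζ) m_{h,k}/ρ_h
  + p_h ∂_k ζ] dx ds` is `P_N`-integrable with `|E Dmo k| ≤ δ`.

## The line: CONSTITUTIVE SPLIT (heat-flux closure ∥ stress closure), common block scale through the seam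

The two conjuncts are the two classical constitutive closures of Euler hydrodynamics and have DIFFERENT
microscopic content and different catalogued obstructions:

* `stub_energyLawClosure` — HEAT-FLUX CLOSURE `q = 0` + cubic moments (`EnergyLawClosure`): VERBATIM the
  crux with the momentum conjunct deleted (same prefix, its own `∃ σ₀`, its own `∃ α`). Content: vanishing
  Euler-order heat current in mean (odd third moments of the local velocity law) plus contact energy transfer
  `→ p u`, along the deterministic dynamics; it is the conjunct that carries the CUBIC velocity moment, i.e. the
  `HighMomentumCutoff` obstruction (in this route answered one level up by `ExpVelocityMomentBound`, K1, via
  `ExpRateGivesCubicUI`/`EnergyCurrentTails`), and the rest-frame heat-current witness of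
  `Literature.Barriers.AtomisticToContinuum.BoltzmannHypothesisBarrierNarrow` kernel (5) (free gas). This stub
  is a CONSEQUENCE of the crux (`energyLawClosure_of_mesoFluxClosure`, proved below): work on it is never
  wasted, and a refutation of it refutes the crux (and both wanting routes) at once.
* `stub_momentumLawClosure` — STRESS CLOSURE `P = p𝟙` AT EVERY MESOSCOPIC SCALE (`MomentumLawClosureAllScales`):
  the crux's momentum conjunct with `∃ α` strengthened to `∀ α ∈ (0,1/3)`. Content: isotropy of the mean
  kinetic stress (local-Maxwellian QUADRATIC moments — bounded in mean by energy conservation, no fast-particle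
  input) and the contact virial identity in mean (collisional momentum transfer → excess pressure
  `ρθ(Z(ρσ³) − 1)𝟙`, Spohn1991 Part I §3.1 (3.15)); obstruction: persistent anisotropic/ring correlations of
  the deterministic gas at fixed reduced density (BoltzmannHypothesis / MacroErgodicity barriers — NOT evaded,
  isolated; kernel (4) of the narrow barrier: equal parameters, anisotropic stress `2e⊗e`). Scale-uniformity is
  asked of THIS conjunct only, because the seam needs one common `α` and the barrier-carrying energy conjunct is
  kept at its weakest (`∃ α`, exactly as any proof of the crux delivers it): the momentum-flux nonlinearity
  `m_h⊗m_h/ρ_h + p_h𝟙` involves only fields whose block fluctuations are `O((N+1)^{(3α-1)/2}) → 0` at every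
  `α < 1/3`, so a mechanism giving stress closure at one mesoscopic scale is expected to give it at all.
* Seam `MesoFluxClosure_of (hE : stub E) (hM : stub M) : MesoFluxClosure` — kernel-checked, no `sorry`
  (axioms ⊆ {propext, Classical.choice, Quot.sound}): `σ₀ := min σ₀ᴱ σ₀ᴹ`; take the block exponent `α` from
  the energy stub, specialise the momentum stub to that `α`; `N₀ := max N₀ᴱ N₀ᴹ`; re-pair the conjuncts. The
  `let`-block of the crux is matched definitionally by the reducible block abbreviations below (verbatim the
  crux's `let ρb mb eb pb mg Den Dmo`).

Independence of the two stubs (why this is a split and not a shred): in the free-gas kernel of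
`BoltzmannHypothesisBarrierNarrow` a symmetric two-atom velocity law has zero heat current but anisotropic
stress (energy law closes, momentum law fails), while an isotropic law with a non-vanishing third moment does
the opposite — neither conjunct controls the other. Neither stub is the crux (each drops one conservation
law; the momentum stub is moreover scale-uniform) nor the summit (no convergence statement at `t > 0`): BC3
probes `stub → MesoFluxClosure` and `stub → HydrodynamicLimit` by `first | exact? | simpa | aesop` FAIL
(planner folder `bc/*.lean`, results in `Lines/birth.md`).

Hardest stub: `stub_energyLawClosure` (cubic moment + heat flux along deterministic spheres at fixed density;
no a-priori fast-particle bound in tree or print — NachtergaeleYau2003 §2.3 Assumption II.1 "no proof";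
OllaVaradhanYau1993 §1 modified the kinetic energy to avoid it). Foreseen layer below it (NOT filed; provers
attach lemmas with `--supports stmt-AtomisticToContinuum-9450`): exact weak energy balance along good
trajectories (kinetic + collisional transfer, `Literature.Analysis.FluidPDE.CollisionalTransfer`) ∥ mean
kinetic heat-current closure given cubic UI (`ExpTailStaging.EnergyCurrentTails`, stmt-9235) ∥ mean contact
energy-transfer closure `→ (p − ρθ) u·∇ζ`.

Disproof used: none on file (`ledger crux ls stmt-AtomisticToContinuum-9450`: no workfiles at registration,
2026-08-17). Negatives index (`ledger negatives --problem AtomisticToContinuum`, 20 entries, 2026-08-17): no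
refuted statement is a flux closure in mean; the nearest, `StrongClosureWeakBV.GeneralStrongClosure`
(stmt-9395, refuted-misstated through the EMPTY horizon `T ≤ 0` and a non-measurable Euler datum), has no
counterpart: both stubs keep the crux's prefix verbatim (`∀ t ∈ Ico 0 T` is vacuous, not false, for `T ≤ 0`;
`IsHardSphereEulerSolution` carries smoothness), and `EulerCharacteristics.ExpTailBudget` (stmt-14607, an
`exp(−cN)` budget for the cubic tail) is not asked — both stubs are expectations with an `o(1)` budget `δ`.
Sources: OllaVaradhanYau1993 §1, §3 Thm 3.10 p. 537; Yau1991; KipnisLandim1999 Ch. 6; Spohn1991 Part I Ch. 3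
§3.1–3.3; NachtergaeleYau2003 §2.3; Literature.Barriers.AtomisticToContinuum.BoltzmannHypothesisBarrierNarrow,
HighMomentumCutoffBarrierNarrow.
-/

noncomputable section

open MeasureTheory Filter Set Topology
open scoped ENNReal BigOperators

namespace Summit.AtomisticToContinuum.HydrodynamicLimit.Cruxes.MesoFluxClosure.Birth

open Literature.MathematicalPhysics.KineticTheory Literature.Analysis.FluidPDE Literature.Analysis.FunctionSpaces
open Summit.AtomisticToContinuum.HydrodynamicLimit.Theses.ExpTailStaging (MesoFluxClosure)

/-! ### Block (mesoscopic) abbreviations — verbatim the `let`-block of `MesoFluxClosure` (all reducible) -/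

/-- A hard-sphere flow of `N + 1` spheres of reduced diameter `σ` on `𝕋³`. -/
abbrev Flow (σ : ℝ) (N : ℕ) : Type :=
  HardSphereFlow (Literature.Analysis.FluidPDE.Torus.geometry (Fin 3)) (hsDiameter σ N) (N + 1)

/-- The mesoscopic block scale `h_N = (N+1)^{-α}` — verbatim the `let h` of `MesoFluxClosure`. -/
abbrev blockScale (α : ℝ) (N : ℕ) : ℝ :=
  ((N + 1 : ℕ) : ℝ) ^ (-α)

variable {N : ℕ}

/-- Block (kernel-mollified) empirical density at `x`, scale `h` — verbatim the `let ρb` of `MesoFluxClosure`. -/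
abbrev blockDensity (h : ℝ) (w : Config (N + 1) (Fin 3) T3) (x : T3) : ℝ :=
  empiricalDensityField w (fun y => Torus.kernel h (y - x))

/-- Block empirical momentum at `x`, scale `h` — verbatim the `let mb` of `MesoFluxClosure`. -/
abbrev blockMomentum (h : ℝ) (w : Config (N + 1) (Fin 3) T3) (x : T3) : V3 :=
  empiricalMomentumField w (fun y => Torus.kernel h (y - x))

/-- Block empirical energy at `x`, scale `h` — verbatim the `let eb` of `MesoFluxClosure`. -/
abbrev blockEnergy (h : ℝ) (w : Config (N + 1) (Fin 3) T3) (x : T3) : ℝ :=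
  empiricalEnergyField w (fun y => Torus.kernel h (y - x))

/-- Block virial pressure `p_h = hsPressure σ ρ_h θ_h`, `θ_h = (2/3)(e_h/ρ_h − |m_h|²/(2ρ_h²))` — verbatim the
`let pb` of `MesoFluxClosure`. -/
abbrev blockPressure (σ h : ℝ) (w : Config (N + 1) (Fin 3) T3) (x : T3) : ℝ :=
  hsPressure σ (blockDensity h w x)
    (2 / 3 * (blockEnergy h w x / blockDensity h w x - ‖blockMomentum h w x‖ ^ 2 / (2 * blockDensity h w x ^ 2)))

/-- The advected test gradient `m_h · ∇ζ` at `x` — verbatim the `let mg` of `MesoFluxClosure`. -/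
abbrev blockMomentumGrad (h : ℝ) (ζ : T3 → ℝ) (w : Config (N + 1) (Fin 3) T3) (x : T3) : ℝ :=
  ∑ j : Fin 3, blockMomentum h w x j * Torus.partialDeriv j ζ x

/-- ENERGY-LAW DEFECT over `[t₁, t₂]` tested with `ζ` at block scale `h` — verbatim the `let Den` of
`MesoFluxClosure`: `⟨e(t₂) − e(t₁), ζ⟩ − ∫_{t₁}^{t₂} ∫ (e_h + p_h)/ρ_h · (m_h·∇ζ) dx ds`. -/
abbrev energyDefect (σ h : ℝ) (Ψ : Flow σ N) (t₁ t₂ : ℝ) (ζ : T3 → ℝ) (z : Config (N + 1) (Fin 3) T3) : ℝ :=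
  empiricalEnergyField (Ψ.flow t₂ z) ζ - empiricalEnergyField (Ψ.flow t₁ z) ζ -
    ∫ s in Set.Icc t₁ t₂, ∫ x : T3,
      (blockEnergy h (Ψ.flow s z) x + blockPressure σ h (Ψ.flow s z) x) / blockDensity h (Ψ.flow s z) x *
        blockMomentumGrad h ζ (Ψ.flow s z) x

/-- `k`-TH MOMENTUM-LAW DEFECT over `[t₁, t₂]` tested with `ζ` at block scale `h` — verbatim the `let Dmo` of
`MesoFluxClosure`: `⟨m(t₂) − m(t₁), ζ⟩_k − ∫_{t₁}^{t₂} ∫ [(m_h·∇ζ) m_{h,k}/ρ_h + p_h ∂_kζ] dx ds`. -/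
abbrev momentumDefect (σ h : ℝ) (Ψ : Flow σ N) (t₁ t₂ : ℝ) (ζ : T3 → ℝ) (k : Fin 3)
    (z : Config (N + 1) (Fin 3) T3) : ℝ :=
  empiricalMomentumField (Ψ.flow t₂ z) ζ k - empiricalMomentumField (Ψ.flow t₁ z) ζ k -
    ∫ s in Set.Icc t₁ t₂, ∫ x : T3,
      (blockMomentumGrad h ζ (Ψ.flow s z) x * blockMomentum h (Ψ.flow s z) x k / blockDensity h (Ψ.flow s z) x +
        blockPressure σ h (Ψ.flow s z) x * Torus.partialDeriv k ζ x)

/-! ### The two stub statements (named `Prop`s; the registered stubs assert them) -/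

/-- **E · EnergyLawClosure** — MESOSCOPIC ENERGY-LAW (HEAT-FLUX) CLOSURE IN MEAN: the crux `MesoFluxClosure`
with its momentum conjunct deleted, everything else verbatim (prefix, `∃ σ₀`, `∃ α ∈ (0,1/3)`, `∀ t < T`,
windows, smooth `ζ`, budget `δ`, `∃ N₀`): eventually in `N` the energy-law defect at block scale
`(N+1)^{-α}` is integrable under the initial local Gibbs law and has expectation of modulus `≤ δ`.
Why plausibly true: local-Maxwellian odd third moments vanish and contact energy transfer averages to `p u`;
the open inputs are the cubic velocity moment along the deterministic flow (fast particles; in route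
ExpTailStaging supplied by `ExpVelocityMomentBound` ⇒ `EnergyCurrentTails`) and the mean vanishing of the
rest-frame heat current (the free-gas witness of `BoltzmannHypothesisBarrierNarrow` (5) is what collisions must
destroy). Size: open-problem (hardest stub). A consequence of the crux (`energyLawClosure_of_mesoFluxClosure`). -/
def EnergyLawClosure : Prop :=
  ∀ (a₀ θ₀ : T3 → ℝ) (u₀ : T3 → V3), Continuous a₀ → Continuous θ₀ → Continuous u₀ →
    (∀ x, 0 < a₀ x) → (∀ x, 0 < θ₀ x) →
    ∃ σ₀ : ℝ, 0 < σ₀ ∧ ∀ σ : ℝ, 0 < σ → σ < σ₀ →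
      ∀ (T : ℝ) (ρ θ : ℝ → T3 → ℝ) (u : ℝ → T3 → V3), IsHardSphereEulerSolution σ T ρ u θ →
        ∀ Φ : (N : ℕ) → Flow σ N,
          TendstoHydroFieldsAt (fun N => localGibbsLaw σ a₀ u₀ θ₀ N (Φ N)) Φ ρ u θ 0 →
            ∃ α : ℝ, 0 < α ∧ α < 1 / 3 ∧
              ∀ t ∈ Set.Ico 0 T, ∀ t₁ t₂ : ℝ, 0 ≤ t₁ → t₁ ≤ t₂ → t₂ ≤ t →
                ∀ ζ : T3 → ℝ, Torus.IsSmooth ζ → ∀ δ : ℝ, 0 < δ → ∃ N₀ : ℕ, ∀ N : ℕ, N₀ ≤ N →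
                  Integrable (energyDefect σ (blockScale α N) (Φ N) t₁ t₂ ζ) (localGibbsLaw σ a₀ u₀ θ₀ N (Φ N)) ∧
                    |∫ z, energyDefect σ (blockScale α N) (Φ N) t₁ t₂ ζ z ∂(localGibbsLaw σ a₀ u₀ θ₀ N (Φ N))| ≤ δ

/-- **M · MomentumLawClosureAllScales** — MESOSCOPIC MOMENTUM-LAW (STRESS) CLOSURE IN MEAN AT EVERY MESOSCOPIC
SCALE: the crux's momentum conjunct with the same prefix and its own `∃ σ₀`, but for EVERY block exponent
`α ∈ (0, 1/3)` (instead of one): eventually in `N` (with `N₀` depending on `α`) the three momentum-law defects at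
block scale `(N+1)^{-α}` are integrable under the initial local Gibbs law with expectations of modulus `≤ δ`.
Why plausibly true: the kinetic stress is a QUADRATIC velocity moment, bounded in mean by energy conservation
(no fast-particle input), its mean isotropy is the local-Maxwellian second-moment identity, and the collisional
momentum transfer is the contact virial `ρθ(Z(ρσ³) − 1)𝟙` (Spohn1991 I §3.1 (3.15)); block fluctuations are
`O((N+1)^{(3α−1)/2}) → 0` at every `α < 1/3`, so scale-uniformity costs nothing a one-scale proof would not
pay. Why it might fail: persistent anisotropic (ring/recollision) velocity correlations of the deterministic gas
at fixed reduced density — the stress analogue of the Boltzmann-hypothesis gap (barrier kernel (4)). Size: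
open-problem (easier of the two: no cubic moment, no heat current). -/
def MomentumLawClosureAllScales : Prop :=
  ∀ (a₀ θ₀ : T3 → ℝ) (u₀ : T3 → V3), Continuous a₀ → Continuous θ₀ → Continuous u₀ →
    (∀ x, 0 < a₀ x) → (∀ x, 0 < θ₀ x) →
    ∃ σ₀ : ℝ, 0 < σ₀ ∧ ∀ σ : ℝ, 0 < σ → σ < σ₀ →
      ∀ (T : ℝ) (ρ θ : ℝ → T3 → ℝ) (u : ℝ → T3 → V3), IsHardSphereEulerSolution σ T ρ u θ →
        ∀ Φ : (N : ℕ) → Flow σ N,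
          TendstoHydroFieldsAt (fun N => localGibbsLaw σ a₀ u₀ θ₀ N (Φ N)) Φ ρ u θ 0 →
            ∀ α : ℝ, 0 < α → α < 1 / 3 →
              ∀ t ∈ Set.Ico 0 T, ∀ t₁ t₂ : ℝ, 0 ≤ t₁ → t₁ ≤ t₂ → t₂ ≤ t →
                ∀ ζ : T3 → ℝ, Torus.IsSmooth ζ → ∀ δ : ℝ, 0 < δ → ∃ N₀ : ℕ, ∀ N : ℕ, N₀ ≤ N →
                  ∀ k : Fin 3,
                    Integrable (momentumDefect σ (blockScale α N) (Φ N) t₁ t₂ ζ k)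
                        (localGibbsLaw σ a₀ u₀ θ₀ N (Φ N)) ∧
                      |∫ z, momentumDefect σ (blockScale α N) (Φ N) t₁ t₂ ζ k z
                          ∂(localGibbsLaw σ a₀ u₀ θ₀ N (Φ N))| ≤ δ

/-! ### Registered stubs (the open obligations of the line; `sorry` only here) -/

/-- STUB E (open-problem; HARDEST — heat-flux closure + cubic moments along deterministic spheres). -/
theorem stub_energyLawClosure : EnergyLawClosure := by
  sorry

/-- STUB M (open-problem; stress isotropy + contact virial in mean, at every mesoscopic scale). -/
theorem stub_momentumLawClosure : MomentumLawClosureAllScales := by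
  sorry

/-! ### Name-keyed aliases of the stub statements (the hypotheses of the composition; the skeleton audit
admits a hypothesis only if its head constant is a registered obligation or is named like a declared stub) -/
namespace Registered

/-- Alias of `EnergyLawClosure` keyed by the registered stub name. -/
abbrev stub_energyLawClosure : Prop := EnergyLawClosure
/-- Alias of `MomentumLawClosureAllScales` keyed by the registered stub name. -/
abbrev stub_momentumLawClosure : Prop := MomentumLawClosureAllScales

end Registered

/-! ### Composition (PROVED): the two stubs give the crux BY NAME -/

/-- **`stub_energyLawClosure → stub_momentumLawClosure → MesoFluxClosure`** (hypotheses = the two registered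
stub statements by name; kernel-checked, no `sorry`): `σ₀ := min σ₀ᴱ σ₀ᴹ`; the block exponent `α` is the
energy stub's; the momentum stub is specialised to it; `N₀ := max N₀ᴱ N₀ᴹ`; the crux's `let`-block unfolds
to the block abbreviations definitionally. -/
theorem MesoFluxClosure_of (hE : Registered.stub_energyLawClosure) (hM : Registered.stub_momentumLawClosure) :
    MesoFluxClosure := by
  intro a₀ θ₀ u₀ ha hθ hu ha0 hθ0
  obtain ⟨σ₁, hσ₁, H1⟩ := hE a₀ θ₀ u₀ ha hθ hu ha0 hθ0
  obtain ⟨σ₂, hσ₂, H2⟩ := hM a₀ θ₀ u₀ ha hθ hu ha0 hθ0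
  refine ⟨min σ₁ σ₂, lt_min hσ₁ hσ₂, ?_⟩
  intro σ hσ hσlt T ρ θ u hsol Φ h0
  obtain ⟨α, hα0, hα1, HE⟩ := H1 σ hσ (lt_of_lt_of_le hσlt (min_le_left _ _)) T ρ θ u hsol Φ h0
  have HM := H2 σ hσ (lt_of_lt_of_le hσlt (min_le_right _ _)) T ρ θ u hsol Φ h0 α hα0 hα1
  refine ⟨α, hα0, hα1, ?_⟩
  intro t ht t₁ t₂ h₁ h₁₂ h₂ ζ hζ δ hδ
  obtain ⟨N₁, HN₁⟩ := HE t ht t₁ t₂ h₁ h₁₂ h₂ ζ hζ δ hδ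
  obtain ⟨N₂, HN₂⟩ := HM t ht t₁ t₂ h₁ h₁₂ h₂ ζ hζ δ hδ
  refine ⟨max N₁ N₂, fun N hN => ?_⟩
  exact ⟨HN₁ N (le_of_max_le_left hN), HN₂ N (le_of_max_le_right hN)⟩

/-- The same composition concluding the OWNER route's copy of the statement,
`HeatBathForgetting.MesoFluxClosure` (rank-0 target of route HeatBathForgetting; identical text, so the two
decls are definitionally equal). -/
theorem MesoFluxClosure_of_heatBathForgetting (hE : Registered.stub_energyLawClosure)
    (hM : Registered.stub_momentumLawClosure) :
    Summit.AtomisticToContinuum.HydrodynamicLimit.Theses.HeatBathForgetting.MesoFluxClosure :=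
  MesoFluxClosure_of hE hM

/-! ### The energy stub is NECESSARY (a consequence of the crux) -/

/-- `MesoFluxClosure → EnergyLawClosure`: the energy stub is literally the crux's first conjunct, so any proof
of the crux proves it and any refutation of it refutes the crux (kernel-checked, no `sorry`). The momentum stub
is NOT implied by the crux as typed (it asks every mesoscopic scale, the crux one). -/
theorem energyLawClosure_of_mesoFluxClosure (h : MesoFluxClosure) : EnergyLawClosure := by
  intro a₀ θ₀ u₀ ha hθ hu ha0 hθ0
  obtain ⟨σ₀, hσ₀, H⟩ := h a₀ θ₀ u₀ ha hθ hu ha0 hθ0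
  refine ⟨σ₀, hσ₀, ?_⟩
  intro σ hσ hσlt T ρ θ u hsol Φ h0
  obtain ⟨α, hα0, hα1, HC⟩ := H σ hσ hσlt T ρ θ u hsol Φ h0
  refine ⟨α, hα0, hα1, ?_⟩
  intro t ht t₁ t₂ h₁ h₁₂ h₂ ζ hζ δ hδ
  obtain ⟨N₀, HN⟩ := HC t ht t₁ t₂ h₁ h₁₂ h₂ ζ hζ δ hδ
  exact ⟨N₀, fun N hN => (HN N hN).1⟩

/-- Wiring check: the registered stubs feed `MesoFluxClosure_of` as stated. -/
example : MesoFluxClosure :=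
  MesoFluxClosure_of stub_energyLawClosure stub_momentumLawClosure

end Summit.AtomisticToContinuum.HydrodynamicLimit.Cruxes.MesoFluxClosure.Birth

end
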